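import Literature.AlgebraicGeometry.Frobenioids.Prop55Sub
import Literature.AlgebraicGeometry.Frobenioids.UnitTrivializationModelType
import Literature.AlgebraicGeometry.Frobenioids.PerfectionModelFull
import Literature.AlgebraicGeometry.Frobenioids.Prop55SubUntrModelProofs
import Literature.AlgebraicGeometry.Frobenioids.ModelFrobenioidBirat
import Literature.AlgebraicGeometry.Frobenioids.PerfectionFrobeniusCompactHolds
import Literature.AlgebraicGeometry.Frobenioids.PerfectionIsFrobenioid
import Literature.AlgebraicGeometry.Frobenioids.PerfectionUnitsIsoGeneral
import Literature.AlgebraicGeometry.Frobenioids.PerfectionUntrCommuteEquiv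
import Literature.AlgebraicGeometry.Frobenioids.PerfectionBiratCommuteEquiv
import Literature.AlgebraicGeometry.Frobenioids.Prop55iiiRlfModel
import Literature.AlgebraicGeometry.Frobenioids.Prop55SubStandardHolds
import Literature.AlgebraicGeometry.Frobenioids.Prop55SubRatStdRlfHolds
import Literature.AlgebraicGeometry.Frobenioids.PerfectionModelType
import Literature.AlgebraicGeometry.Frobenioids.BirationalizationFrobenioidGeneral
import HarnessLib

/-!
# Frobenioids I, Proposition 5.5: sub-DAG row `FrdI:Prop5.5/P55-L00` («Assembly55») — slot closers
# over THE constructions (proof-only companion of `Prop55Sub.lean`)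

Mochizuki, *The geometry of Frobenioids I: the general theory*, Kyushu J. Math. **62** (2008)
293–400, §5, Proposition 5.5, kurims text p. 104 ll. 27–44 (read on this seat's render
`paper:url-bbf705efa10f` p. 104 ll. 27–44; proof p. 104 l. 45 – p. 105 l. 29)
[cite: MochizukiFrdI2008, Prop. 5.5 p.104].

PROOF-ONLY file (abc-iut cell, seat abc-iut-L6-t6, sub-DAG `plan/L1/SUBDAG-FrdI-Thm51iv-Prop55.md`,
row `FrdI:Prop5.5/P55-L00` "per-item closing = the slot `_holds`"; statements file `Prop55Sub.lean`,
seat abc-iut-w4-d084, never edited here).  It files the fully-qualified slot closers that the piece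
holders left implicit, each a one-line application of LANDED content theorems (credited by name):

* `FrdI.Prop55Sub.prop55iii_untr_model_holds` — the slot `Prop55iii_untr_model F hF` ((iii),
  "Moreover, `C^un-tr` … [is] always of model type", p. 104 l. 37): pre-model type is
  `PreFrobenioid.isOfModelType_untr'` (first conjunct) and birationally Frobenius-normalized type at THE
  birationalization of `C^un-tr` is `PreFrobenioid.isOfBiratFrobeniusNormalizedType_biratData_untr` —
  both seat abc-iut-w4-d108, `UnitTrivializationModelType.lean` (Thm. 5.1 (iv) applied to the unit-trivial
  Frobenioid `C^un-tr`); print's antecedents "Frobenius-isotropic and Frobenius-normalized type" are not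
  used.
* `FrdI.Prop55Sub.prop55iv_holds` — item (iv) packaged as ONE kernel name for the node
  `FrdI:Prop5.5(iv)`: the three slots `Prop55iv_pf` (closer `prop55iv_pf_holds`, seat abc-iut-L1-d9,
  `PerfectionModelFull.lean`), `Prop55iv_untr` (`Prop55iv_untr_holds`, seat abc-iut-L1-t2,
  `Prop55SubUntrModelProofs.lean`) and `Prop55iv_rlf` (`prop55iv_rlf_holds`, seat abc-iut-L1-d2,
  `ModelFrobenioidBirat.lean`), under the standing hypotheses `ModelFrobenioid.Hypotheses Φ B` of
  Thm. 5.2 (which make the model category a Frobenioid and `B` group-like) and `Φ` perf-factorial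
  (needed to FORM the realification, Prop. 5.3), for every perfected divisor datum `Div_B^pf`.

Slots of `Prop55Sub.lean` closed ELSEWHERE (not restated): `Prop55i` (`prop55i_holds`, abc-iut-L1-d9),
`Prop55ii_birat` (`Prop55ii_birat_holds`, abc-iut-w4-d044), `Prop55iii_rlf_model`
(`prop55iii_rlf_model_holds`, abc-iut-L1-d2), `Prop55iii_untr_rlf_standard`
(`prop55iii_untr_rlf_standard_holds`, abc-iut-w4-d084).  Slots still OPEN at this file's date and
deliberately NOT touched here: `Prop55ii_untr`, `Prop55iii_pf_standard` / `_pf_ratStd` / `_pf_model`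
(conditional forms `prop55iii_pf_standard_of*` landed), `Prop55iii_untr_rlf_ratStd` (conditional
`prop55iii_untr_ratStd_of` + repaired slot `Prop55iii_untr_rlf_ratStd′` landed).
No new notion, no statement re-typed.  HONEST FRAMING: [FrdI] is a refereed, undisputed paper;
nothing here bears on [IUTchIII] Cor. 3.12 beyond supplying kernel-checked inputs by name.
-/

namespace Literature.AlgebraicGeometry.Frobenioids

open CategoryTheory Opposite

namespace FrdI.Prop55Sub

open PreFrobenioid

universe w v v' u u'

section UntrModel

variable {D : Type u} [Category.{v} D] {Φ : Dᵒᵖ ⥤ CommMonCat.{w}}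
  {C : Type u'} [Category.{v'} C] (F : C ⥤ ElemFrobenioid Φ)

/-- **The slot `FrdI.Prop55Sub.Prop55iii_untr_model` DISCHARGED** ([FrdI] Prop. 5.5 (iii), "Moreover,
`C^un-tr` … [is] always of model type", p. 104 l. 37; proof p. 105 ll. 9–11 "by Theorem 5.1 (iv)"):
for ANY Frobenioid `C → F_Φ`, the unit-trivialization `C^un-tr → F_Φ` (`untrFunctor hF`) is of pre-model
type and THE birationalization of the Frobenioid `C^un-tr` is of birationally Frobenius-normalized type —
seat abc-iut-w4-d108's `isOfModelType_untr'` and `isOfBiratFrobeniusNormalizedType_biratData_untr`; the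
printed antecedents (Frobenius-isotropic, Frobenius-normalized type) are not needed.
[cite: MochizukiFrdI2008, Prop. 5.5 (iii) p.104] -/
theorem prop55iii_untr_model_holds (hF : IsFrobenioid F) : Prop55iii_untr_model F hF :=
  fun _ _ => ⟨(isOfModelType_untr' hF).1, isOfBiratFrobeniusNormalizedType_biratData_untr hF _⟩

end UntrModel

section ModelData

variable {D : Type u} [Category.{v} D] (Φ B : Dᵒᵖ ⥤ CommMonCat.{w}) (DivB : B ⟶ monoidGp Φ)

/-- **[FrdI] Prop. 5.5 (iv), all three clauses, as one kernel name** (node `FrdI:Prop5.5(iv)`): for `C`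
the model Frobenioid of `(Φ, B, Div_B)` under the standing hypotheses of Thm. 5.2 and `Φ` perf-factorial,
"there is a natural equivalence of categories [compatible with the functors to the respective elementary
Frobenioids] between `C^pf` (respectively, `C^un-tr`; `C^rlf`) and the model Frobenioid associated to the
data `Φ^pf, B^pf, B^pf → (Φ^gp)^pf` (respectively, `Φ, Φ^birat, Φ^birat ↪ Φ^gp`; `Φ^rlf, ℝ · Φ^birat,
ℝ · Φ^birat ↪ (Φ^rlf)^gp`)" — the conjunction of the slots `Prop55iv_pf` (for every perfected divisor
datum `Div_B^pf`), `Prop55iv_untr`, `Prop55iv_rlf` of `Prop55Sub.lean`, closed by `prop55iv_pf_holds`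
(abc-iut-L1-d9), `Prop55iv_untr_holds` (abc-iut-L1-t2), `prop55iv_rlf_holds` (abc-iut-L1-d2).
[cite: MochizukiFrdI2008, Prop. 5.5 (iv) p.104] -/
theorem prop55iv_holds (h : ModelFrobenioid.Hypotheses Φ B) (hΦ : IsPerfFactorialOn Φ) :
    (∀ DivBpf : perfectionFunctor B ⟶ monoidGp (perfectionFunctor Φ), Prop55iv_pf Φ B DivB h DivBpf) ∧
      Prop55iv_untr Φ B DivB h ∧
      Prop55iv_rlf Φ B DivB (fun A b => (h.isGroupLike_rat (unop A)).isUnit b) hΦ :=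
  ⟨fun DivBpf => prop55iv_pf_holds h DivBpf, Prop55iv_untr_holds Φ B DivB h,
    prop55iv_rlf_holds Φ B DivB _ hΦ⟩

end ModelData

/-! ### v2 (append-only): the remaining per-item packaging and the unconditional `C^pf`-standard closer -/

section ItemsV2

variable {D : Type u} [Category.{v} D] {Φ : Dᵒᵖ ⥤ CommMonCat.{w}}
  {C : Type u'} [Category.{v'} C] (F : C ⥤ ElemFrobenioid Φ)

/-- **The slot `FrdI.Prop55Sub.Prop55iii_pf_standard` DISCHARGED UNCONDITIONALLY** ([FrdI] Prop. 5.5 (iii),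
first sentence, "If `C` is of standard … type, then so is `C^pf`", p. 104 ll. 36–37; proof p. 105 ll. 11–20):
seat abc-iut-w5-d042's clause-by-clause `prop55iii_pf_standard_of` (Def. 3.1 (i) for `Perfection.ops hF`) with
its two named inputs now supplied by landed theorems — Prop. 3.2 (iii) "`C^pf` is a Frobenioid" for `C` of
Frobenius-isotropic type (`PreFrobenioid.Perfection.isFrobenioid`, seats abc-iut-L1-d9 / abc-iut-L1-d1) and the
Frobenius-compact clause (b) via Prop. 5.5 (i) (`PreFrobenioid.Perfection.hb_of_prop55i`, seat abc-iut-w5-d190,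
fed with `prop55i_holds`, seat abc-iut-L1-d9).  The slot's own antecedents (Frobenius-isotropic,
Frobenius-normalized, `C` standard) are exactly print's. [cite: MochizukiFrdI2008, Prop. 5.5 (iii) p.104] -/
theorem prop55iii_pf_standard_holds (hF : IsFrobenioid F) : Prop55iii_pf_standard F hF := fun hiso hnorm hS =>
  prop55iii_pf_standard_of hF (Perfection.isFrobenioid hF hiso)
    (Perfection.hb_of_prop55i hF hiso hnorm hS (fun A => prop55i_holds hF A)) hiso hnorm hS

/-- **[FrdI] Prop. 5.5 (ii), both clauses, as one kernel name** (node `FrdI:Prop5.5(ii)`): "a natural equivalence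
of categories … between `(C^pf)^un-tr` and `(C^un-tr)^pf` and between `(C^pf)^birat` and `(C^birat)^pf`" — the
conjunction of the slots `Prop55ii_untr` (closer `Prop55ii_untr_holds`, seat abc-iut-w5-d026,
`PerfectionUntrCommuteEquiv.lean`) and `Prop55ii_birat` (closer `Prop55ii_birat_holds`, seat abc-iut-w4-d044,
`PerfectionBiratCommuteEquiv.lean`). [cite: MochizukiFrdI2008, Prop. 5.5 (ii) p.104] -/
theorem prop55ii_holds (hF : IsFrobenioid F) : Prop55ii_untr F hF ∧ Prop55ii_birat F hF :=
  ⟨Prop55ii_untr_holds hF, Prop55ii_birat_holds F hF⟩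

/-- **[FrdI] Prop. 5.5 (iii), the `C^un-tr` / `C^rlf` clauses, as one kernel name** (node `FrdI:Prop5.5(iii)`,
sub-DAG rows P55-L05/L07): "Moreover, `C^un-tr`, `C^rlf` are always of model type. Finally, suppose further that
`C` is not of group-like type. Then if `C` is of standard (respectively, rationally standard) type, then so are
`C^un-tr`, `C^rlf`" (p. 104 ll. 37–39) — for `Φ` perf-factorial (needed to FORM `C^rlf`): the conjunction of the
slots `Prop55iii_untr_model` (`prop55iii_untr_model_holds`, this file v1), `Prop55iii_rlf_model`
(`prop55iii_rlf_model_holds`, seat abc-iut-L1-d2), `Prop55iii_untr_rlf_standard`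
(`prop55iii_untr_rlf_standard_holds`, seat abc-iut-w4-d084) and the repaired rationally-standard slot
`Prop55iii_untr_rlf_ratStd′` (`prop55iii_untr_rlf_ratStd'_holds`, seat abc-iut-w5-d250; the unprimed slot has a
free support binder, see `Prop55SubRatStdSlot.lean`). [cite: MochizukiFrdI2008, Prop. 5.5 (iii) p.104] -/
theorem prop55iii_untr_rlf_holds (hF : IsFrobenioid F) (hΦ : IsPerfFactorialOn Φ) :
    Prop55iii_untr_model F hF ∧ Prop55iii_rlf_model F hΦ ∧ Prop55iii_untr_rlf_standard F hF hΦ ∧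
      Prop55iii_untr_rlf_ratStd' F hF hΦ :=
  ⟨prop55iii_untr_model_holds F hF, prop55iii_rlf_model_holds F hΦ, prop55iii_untr_rlf_standard_holds F hF hΦ,
    prop55iii_untr_rlf_ratStd'_holds F hF hΦ⟩

end ItemsV2

/-! ### v3 (append-only): the model clause for `C^pf`, unconditional -/

section ItemsV3

variable {D : Type u} [Category.{v} D] {Φ : Dᵒᵖ ⥤ CommMonCat.{w}}
  {C : Type u'} [Category.{v'} C] (F : C ⥤ ElemFrobenioid Φ)

/-- **The slot `FrdI.Prop55Sub.Prop55iii_pf_model` DISCHARGED UNCONDITIONALLY** ([FrdI] Prop. 5.5 (iii),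
first sentence, "If `C` is of … model type, then so is `C^pf`", p. 104 ll. 36–37; proof p. 105 ll. 11–20):
seat abc-iut-w4-d008's `prop55iii_pf_model_of_isFrobenioid_birat` (pre-model conjunct
`Perfection.isOfPreModelType_of`; birational conjunct seat abc-iut-w5-d042's
`PerfectionBirat.isOfBiratFrobeniusNormalizedType_biratData_perfection`), whose one named input — Prop. 4.4 (ii)
"`C^birat` is a Frobenioid" — is now supplied WITHOUT any isotropy hypothesis by seat abc-iut-L6-t20's
`isFrobenioid_biratOps_toFunctor_general` (author's 2024 form of Prop. 4.4 (ii) for every Frobenioid of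
birationally Frobenius-normalized type), the birational Frobenius-normalization being the slot's OWN
hypothesis (second conjunct of "`C` is of model type", the two renderings of Def. 4.5 (i) agreeing by
`isBiratFrobeniusNormalized_iff_biratData`).  This removes the residual "`C` of isotropic type" of
`prop55iii_pf_model_of_isOfIsotropicType`. [cite: MochizukiFrdI2008, Prop. 5.5 (iii) p.104] -/
theorem prop55iii_pf_model_holds (hF : IsFrobenioid F) : Prop55iii_pf_model F hF := fun hfi hfn hPf h =>
  prop55iii_pf_model_of_isFrobenioid_birat hF
    (isFrobenioid_biratOps_toFunctor_general hF (hasBiratSquares_of_isFrobenioid hF) fun A =>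
      (isBiratFrobeniusNormalized_iff_biratData A).mpr (h.2.obj A))
    hfi hfn hPf h

/-- **[FrdI] Prop. 5.5 (iii), first sentence, the "standard" and "model" clauses for `C^pf`, as one kernel
name** (node `FrdI:Prop5.5(iii)`, sub-DAG row P55-L06): "If `C` is of standard (respectively, … model) type, then
so is `C^pf`" — both UNCONDITIONAL at THE perfection (`prop55iii_pf_standard_holds`, `prop55iii_pf_model_holds`).
The "rationally standard" clause (`Prop55iii_pf_ratStd`, at the canonical support) remains CONDITIONAL on
Def. 4.5 (iii)(b) for `C^pf` (seat abc-iut-w4-d108's `prop55iii_pf_ratStd_primarySupp_of`, input `hK`) and is not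
packaged here. [cite: MochizukiFrdI2008, Prop. 5.5 (iii) p.104] -/
theorem prop55iii_pf_holds (hF : IsFrobenioid F) : Prop55iii_pf_standard F hF ∧ Prop55iii_pf_model F hF :=
  ⟨prop55iii_pf_standard_holds F hF, prop55iii_pf_model_holds F hF⟩

end ItemsV3

end FrdI.Prop55Sub

end Literature.AlgebraicGeometry.Frobenioids
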